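import Summits.BirchSwinnertonDyer.Rank1Residual.GaloisImage.KatoKuriharaWitnessPairOfZetaBody
import Summits.BirchSwinnertonDyer.BirchSwinnertonDyer.Theorems.KimAtThreeD7uKolyvaginPairBlochKato
import Summits.BirchSwinnertonDyer.BirchSwinnertonDyer.Theorems.KimAtThreeD7uTamagawaSharpLevel
import Summits.BirchSwinnertonDyer.BirchSwinnertonDyer.Theorems.KimAtThreeD7uTamagawaDefect
import Summits.BirchSwinnertonDyer.Rank1Residual.GaloisImage.TorsionReductionOfLe
import HarnessLib

/-!
# The TAMAGAWA-DIVISIBLE bad places, XXIV: the `𝓕_u`-WITNESS of part XXIII FROM KATO'S EULER SYSTEM —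
# n1011's ★ PK-6₂ witness pair (T-PK62-PAIR) with THEOREM D replaced by THEOREM D-u (seat gen 2): the
# Kolyvagin systems lie in [MR04] Remark A.5's `𝓕_u`, and NO `hbad` (anomalous bad places allowed)
# (cell `bsd-addord`, seat w2-tamdiv gen 7; route W2 `KimAtThreeKolyvagin`, items 19679 / 19562 / 19599 (TD),
# 19560 (C3))

HONEST FRAMING: TOOL theorems (no definition, no named fact, no `sorry`); closes nothing by itself;
nothing is booked; BSD is not proved by any of this.  This is an END-shaped producer with DISPLAYED
hypotheses, exactly as n1011-p13's `KatoValue.exists_katoKuriharaWitnessAt_pair_of_zetaBody` (T-PK62-PAIR,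
whose statement is copied binder by binder): (a) Kato's cited fact's matrix `ZetaBody W 3 P.f ι κK Λ c d a A z x`
on displayed witnesses (the Literature NAMED FACT `Kato2004.exists_eulerSystem_expStar_values` supplies them
for every `W` with `W[3]` irreducible), (b) the CONSTRUCTION-SHAPED (P-EXP) riders
`KatoExpStarFiniteLevelAt W 3 j t v₃ Λ (Λfin j)` at the two depths (never `_holds`), (c) `𝓕_can,3 = ⊤` at the
two depths (`htopk`/`htopm`: `t = 0` rows, Mazur–Rubin Lemma A.1), (d) the per-level VALUE ROWS
`hvalk`/`hvalm` (T-PK6-VROW's OUT, displayed), (e) the data: two depths `k ≤ m`, the pinned reduction `π`,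
canonical data `D`, `D″` for the SAME `η` with primes usable for `(c, d, A, N)` and Kolyvagin of levels
`k + 1`, `m + 1`.  DELETED relative to T-PK62-PAIR: THEOREM D's row certificate `hbad` (no `3`-torsion
over `ℚ_w` at the bad `w ≠ 3`) — THEOREM D-u (seat gen 2,
`KimAtThreeD7uKolyvaginPairBlochKato.exists_isKolyvaginSystem_pair_blochKatoSelmerStructure_of_unramified_odd`)
reads the unramifiedness of Kato's classes away from `3` ((C2) of `ZetaBody`, `hbody.2.1`) instead, at
EVERY bad place, anomalous or not.  ADDED to the conclusion: the two Kolyvagin systems lie in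
`KS(E[3^k·3], 𝓕_u, D)` / `KS(E[3^m·3], 𝓕_u, D″)` for `𝓕_u = blochKatoSelmerStructure 3 (tateTorsionDatum W 3 ·) ⊤`
— the input shape `hwit` of part XXIII's deep TamDiv bound
(`KimAtThreeD7uTamagawaKuriharaDeep.natCast_le_kuriharaPartialDeepInfty_of_witnesses_of_pow_succ_dvd`).

## What and how

`exists_katoKuriharaWitnessAt_pair_blochKato_of_zetaBody`: T-PK62-PAIR's proof with THEOREM D-u in place of
THEOREM D (fed `hbody.1`, the torsion coefficient systems of GZ-2 with pins `rfl`, `hbody.2.1` as `hur`);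
the witness clause (I4) needs `κ ∈ KS(𝓕_can)`, obtained from `KS(𝓕_u) ≤ KS(𝓕_can)` (part IX
`kolyvaginSystems_mono` over part XVIII `blochKatoSelmerStructure_relaxed_le_propagatedSelmerStructure`, `p`
odd); (DICT3) per level by n1011-p13's T-PK6-GEN
`KatoValue.GeneralLevel.exists_unit_apply_localization_eq_of_derivativeFamily` on the value rows; diagonal
packaging `κ′ = κ`, `κu′ = κu`.  `exists_katoKuriharaWitnessAt_blochKato_of_zetaBody`: the one-depth reading
(`k = m`, `π = id`).

HONEST LIMITS: the value rows and the riders are hypotheses; `htop` restricts to `t = 0` rows in practice;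
nothing about `Λfin`'s construction; closes nothing; 0 defs / 0 facts.

References: K. Kato, Astérisque 295 (2004) (8.1.3), §8.2, Lemma 8.5, §9.4, Thm. 9.7, Ex. 13.3
[Kato2004Asterisque]; C.-H. Kim, AJM 148 = arXiv:2203.12159, §2.2.2, §3.3–§3.4.1, Thm. 3.13
[Kim2022StructureSelmer]; B. Mazur, K. Rubin, Mem. AMS 799 (2004), Def. 3.1.3, Thm. 3.2.4, Prop. 6.2.6,
App. A (33), Remark A.5 [MazurRubin2004]; K. Rubin, *Euler Systems* (2000) Def. 4.4.4, Thm. 4.5.1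
[Rubin2000]; K. Büyükboduk, JNT 129 (2009) Thm. 3.1 [Buyukboduk2009TamagawaDefect].
-/

noncomputable section

-- the cell's Theorems namespace `Summit.BirchSwinnertonDyer.BirchSwinnertonDyer.…` repeats the summit name by design (D-0017)
set_option linter.dupNamespace false

open scoped NumberField TensorProduct ContRepresentation Classical
open CategoryTheory Field Function Finset IsDedekindDomain NumberField WeierstrassCurve
open Rat.HeightOneSpectrum
open Literature.NumberTheory.GaloisRepresentations Literature.NumberTheory.GaloisCohomology
open Literature.NumberTheory.GaloisRepresentations.DiscreteGaloisModule
open Literature.NumberTheory.EllipticCurves Literature.NumberTheory.EllipticCurves.ModularForms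
open Literature.NumberTheory.EllipticCurves.Kato2004
open Literature.NumberTheory.EllipticCurves.Kato2004.EulerSystemValues
open Summit.BirchSwinnertonDyer.Rank1Residual.GaloisImage
open Summit.BirchSwinnertonDyer.Rank1Residual.GaloisImage.TorsionCoeff
open Summit.BirchSwinnertonDyer.Rank1Residual.GaloisImage.KatoValue
open Summit.BirchSwinnertonDyer.BirchSwinnertonDyer.Theorems.KimAtThreeD7uKolyvaginPairBlochKato
open Summit.BirchSwinnertonDyer.BirchSwinnertonDyer.Theorems.KimAtThreeD7uTamagawaSharp
open Summit.BirchSwinnertonDyer.BirchSwinnertonDyer.Theorems.KimAtThreeD7uTamagawaDefect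

namespace Summit.BirchSwinnertonDyer.BirchSwinnertonDyer.Theorems.KimAtThreeD7uTamagawaKuriharaWitness

variable (W : WeierstrassCurve ℚ) [W.IsElliptic] [W.IsGloballyMinimal]
  [ContinuousSMul ℤ_[3] (W.tateModule 3)] [Module.Free ℤ_[3] (W.tateModule 3)]
  [Module.Finite ℤ_[3] (W.tateModule 3)]

/-- Local notation: `𝐃F⟦r, τ⟧ ℓ = Σ_{j<ℓ−1} j·σ_{χ_{m(0,r)}(τ_ℓ)}^j` on the level field `ℚ(ζ_{m(0,r)})`
(n1011 PK-1 ★2's field-side spelling, `p = 3`). -/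
local notation3 (prettyPrint := false) "𝐃F⟦" r ", " τ "⟧" =>
  fun ℓ : HeightOneSpectrum (𝓞 ℚ) =>
  ∑ j ∈ Finset.range (((primesEquiv ℓ : Nat.Primes) : ℕ) - 1),
    (j : Module.End ℚ (CyclotomicField (cycLevel 3 0 r) ℚ)) *
      (sigma (cycLevel 3 0 r) (modNCyclotomicCharacter ℚ (cycLevel 3 0 r)
          ((τ : HeightOneSpectrum (𝓞 ℚ) → absoluteGaloisGroup ℚ) ℓ)) :
        CyclotomicField (cycLevel 3 0 r) ℚ →ₐ[ℚ] CyclotomicField (cycLevel 3 0 r) ℚ).toLinearMap ^ j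

set_option backward.isDefEq.respectTransparency false in
/-- **★★ The two-depth Kato–Kurihara witness package IN `𝓕_u`, from `ZetaBody`, THEOREM D-u and the value
rows — NO `hbad`.**  Binders = n1011-p13's `KatoValue.exists_katoKuriharaWitnessAt_pair_of_zetaBody`
VERBATIM with THEOREM D's `hbad` deleted; conclusion = the same two witness clause sets
`KatoKuriharaWitnessAt W k t D v₃ P κf Λk κf`, `KatoKuriharaWitnessAt W m t D″ v₃ P κu Λm κu` and (COMP),
PLUS `κf ∈ KS(E[3^k·3], 𝓕_u, D)` and `κu ∈ KS(E[3^m·3], 𝓕_u, D″)` for [MR04] Remark A.5's structure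
`𝓕_u = blochKatoSelmerStructure 3 (tateTorsionDatum W 3 ·) ⊤` (module docstring).
[cite: Kato2004Asterisque, (8.1.3) (p. 180), §9.4 (p. 188) and Thm. 9.7 (p. 189)]
[cite: Kim2022StructureSelmer, Thm. 3.13 and §2.2.2, §3.3–§3.4.1 (arXiv v3 pp. 12, 17–18)]
[cite: MazurRubin2004, Def. 3.1.3, Thm. 3.2.4, App. A (33) and Remark A.5 (p. 81)] [cite: Rubin2000, Def. 4.4.4] -/
theorem exists_katoKuriharaWitnessAt_pair_blochKato_of_zetaBody
    {N : ℕ} [NeZero N] (P : ModularParametrizationData W N)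
    {ι : (n : ℕ) → (CyclotomicField n ℚ →+* ℂ)} {κK : ℝ}
    {Λ : ∀ (k' : ℕ) (r : Finset (HeightOneSpectrum (𝓞 ℚ))),
      H1 (tateRep W 3) (cycSubgroup 3 k' r) →ₗ[ℤ_[3]] ℚ_[3] ⊗[ℚ] CyclotomicField (cycLevel 3 k' r) ℚ}
    {c d a : ℤ} {A : ℕ}
    {z : ∀ (k' : ℕ) (r : (cyclotomicLevelsRat 3 (badPlaces c d A N)).Ideals),
      H1 (tateRep W 3) ((cyclotomicLevelsRat 3 (badPlaces c d A N)).level k' r.1)}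
    {x : ∀ (k' : ℕ) (r : (cyclotomicLevelsRat 3 (badPlaces c d A N)).Ideals),
      CyclotomicField (cycLevel 3 k' r.1) ℚ}
    (hbody : ZetaBody W 3 P.f ι κK Λ c d a A z x)
    (hirr : W.HasIrreducibleModPGaloisRep 3)
    -- the two depths and THE reduction
    {k m : ℕ} (hkm : k ≤ m)
    (π : (W.torsionGaloisModule (((3 : ℕ) : ℤ) ^ m * ((3 : ℕ) : ℤ))).toContRepresentation →ⁱL
      (W.torsionGaloisModule (((3 : ℕ) : ℤ) ^ k * ((3 : ℕ) : ℤ))).toContRepresentation)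
    (hπ : ∀ y : geomTorsion W (((3 : ℕ) : ℤ) ^ m * ((3 : ℕ) : ℤ)),
      ((π y : geomTorsion W (((3 : ℕ) : ℤ) ^ k * ((3 : ℕ) : ℤ))) : geomPoints W) =
        (((3 : ℕ) : ℤ) ^ (m - k)) • (y : geomPoints W))
    -- the riders at `v₃ ∣ 3`, depths `k` and `m`, same `Λ`
    {t : ℕ} {v₃ : HeightOneSpectrum (𝓞 ℚ)} (hv₃ : ((3 : ℕ) : 𝓞 ℚ) ∈ v₃.asIdeal)
    {Λk : galoisCohomology ((W.torsionGaloisModule (((3 : ℕ) : ℤ) ^ k * ((3 : ℕ) : ℤ))).toLocal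
      (Sum.inr v₃)) 1 →+ ZMod (3 ^ (k + 1))}
    {Λm : galoisCohomology ((W.torsionGaloisModule (((3 : ℕ) : ℤ) ^ m * ((3 : ℕ) : ℤ))).toLocal
      (Sum.inr v₃)) 1 →+ ZMod (3 ^ (m + 1))}
    (hfink : KatoExpStarFiniteLevelAt W 3 k t v₃ Λ Λk) (hfinm : KatoExpStarFiniteLevelAt W 3 m t v₃ Λ Λm)
    -- the two data, canonical for the SAME `η`, with usable Kolyvagin primes
    (D : KolyvaginDatum (W.torsionGaloisModule (((3 : ℕ) : ℤ) ^ k * ((3 : ℕ) : ℤ))))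
    (hT : D.transverse = cyclotomicTransverse (W.torsionGaloisModule (((3 : ℕ) : ℤ) ^ k * ((3 : ℕ) : ℤ))))
    (D'' : KolyvaginDatum (W.torsionGaloisModule (((3 : ℕ) : ℤ) ^ m * ((3 : ℕ) : ℤ))))
    (hT'' : D''.transverse =
      cyclotomicTransverse (W.torsionGaloisModule (((3 : ℕ) : ℤ) ^ m * ((3 : ℕ) : ℤ))))
    {η : (q : HeightOneSpectrum (𝓞 ℚ)) → (ZMod (Ideal.absNorm q.asIdeal))ˣ}
    (hD : D.HasCanonicalComparison (3 ^ (k + 1)) η) (hD'' : D''.HasCanonicalComparison (3 ^ (m + 1)) η)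
    (hPr : D.primes ⊆ (cyclotomicLevelsRat 3 (badPlaces c d A N)).primes)
    (hPr'' : D''.primes ⊆ (cyclotomicLevelsRat 3 (badPlaces c d A N)).primes)
    (hKol : ∀ q ∈ D.primes, Kato.IsKolyvaginPrime W 3 (k + 1) ((primesEquiv q : Nat.Primes) : ℕ))
    (hKol'' : ∀ q ∈ D''.primes, Kato.IsKolyvaginPrime W 3 (m + 1) ((primesEquiv q : Nat.Primes) : ℕ))
    -- `𝓕_can,3 = ⊤` at the two depths (NO `hbad`)
    (htopk : ∀ w : HeightOneSpectrum (𝓞 ℚ), ((primesEquiv w : Nat.Primes) : ℕ) = 3 →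
      propagatedSelmerStructure W 3 k (Sum.inr w) = ⊤)
    (htopm : ∀ w : HeightOneSpectrum (𝓞 ℚ), ((primesEquiv w : Nat.Primes) : ℕ) = 3 →
      propagatedSelmerStructure W 3 m (Sum.inr w) = ⊤)
    -- the VALUE ROWS at depth `k` and at depth `m` (T-PK6-VAL's OUT, displayed)
    (hvalk : ∀ σ : HeightOneSpectrum (𝓞 ℚ) → absoluteGaloisGroup ℚ,
      (∀ q, σ q ∈ (adicCompletionPrime ℚ q).inertia (absoluteGaloisGroup ℚ)) →
      (∀ q, modNCyclotomicCharacter ℚ (Ideal.absNorm q.asIdeal) (σ q) = η q) →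
      ∀ (r : Finset (HeightOneSpectrum (𝓞 ℚ))) (hr : (↑r : Set _) ⊆ D.primes),
        ∃ (s : ℤ_[3]) (u : (ZMod (3 ^ (k + 1)))ˣ)
          (ψ : (ℓ : ℕ) → (ZMod ℓ)ˣ →* Multiplicative (ZMod (3 ^ (k + 1)))),
          (∀ q ∈ r, Function.Surjective (ψ (Ideal.absNorm q.asIdeal))) ∧
          (∃ l ∈ cycIntLattice 3 (cycLevel 3 0 r),
            (((3 : ℕ) : ℤ_[3]) ^ t) • ((1 : ℚ_[3]) ⊗ₜ[ℚ]
              ((r.noncommProd 𝐃F⟦r, σ⟧ (ZetaValue.pairwise_commute_fieldDeriv (cycLevel 3 0 r)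
                  (fun ℓ => modNCyclotomicCharacter ℚ (cycLevel 3 0 r) (σ ℓ))
                  (fun ℓ => ((primesEquiv ℓ : Nat.Primes) : ℕ) - 1) r))
                (x 0 ⟨r, fun _ hq => hPr (hr (Finset.mem_coe.2 hq))⟩ +
                  sigma (cycLevel 3 0 r) (-1) (x 0 ⟨r, fun _ hq => hPr (hr (Finset.mem_coe.2 hq))⟩)))) -
              ((s : ℚ_[3]) ⊗ₜ[ℚ] (1 : CyclotomicField (cycLevel 3 0 r) ℚ)) =
            (((3 : ℕ) : ℤ_[3]) ^ (k + 1)) • (l : ℚ_[3] ⊗[ℚ] CyclotomicField (cycLevel 3 0 r) ℚ)) ∧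
          haveI : NeZero (∏ q ∈ r, Ideal.absNorm q.asIdeal) :=
            ⟨Finset.prod_ne_zero_iff.2 fun q _ h => q.ne_bot (Ideal.absNorm_eq_zero_iff.1 h)⟩
          PadicInt.toZModPow (k + 1) s = (u : ZMod (3 ^ (k + 1))) *
            ((3 : ℕ) : ZMod (3 ^ (k + 1))) ^ t *
              kuriharaNumber P.f (3 ^ (k + 1)) (∏ q ∈ r, Ideal.absNorm q.asIdeal) ψ)
    (hvalm : ∀ σ : HeightOneSpectrum (𝓞 ℚ) → absoluteGaloisGroup ℚ,
      (∀ q, σ q ∈ (adicCompletionPrime ℚ q).inertia (absoluteGaloisGroup ℚ)) →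
      (∀ q, modNCyclotomicCharacter ℚ (Ideal.absNorm q.asIdeal) (σ q) = η q) →
      ∀ (r : Finset (HeightOneSpectrum (𝓞 ℚ))) (hr : (↑r : Set _) ⊆ D''.primes),
        ∃ (s : ℤ_[3]) (u : (ZMod (3 ^ (m + 1)))ˣ)
          (ψ : (ℓ : ℕ) → (ZMod ℓ)ˣ →* Multiplicative (ZMod (3 ^ (m + 1)))),
          (∀ q ∈ r, Function.Surjective (ψ (Ideal.absNorm q.asIdeal))) ∧
          (∃ l ∈ cycIntLattice 3 (cycLevel 3 0 r),
            (((3 : ℕ) : ℤ_[3]) ^ t) • ((1 : ℚ_[3]) ⊗ₜ[ℚ]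
              ((r.noncommProd 𝐃F⟦r, σ⟧ (ZetaValue.pairwise_commute_fieldDeriv (cycLevel 3 0 r)
                  (fun ℓ => modNCyclotomicCharacter ℚ (cycLevel 3 0 r) (σ ℓ))
                  (fun ℓ => ((primesEquiv ℓ : Nat.Primes) : ℕ) - 1) r))
                (x 0 ⟨r, fun _ hq => hPr'' (hr (Finset.mem_coe.2 hq))⟩ +
                  sigma (cycLevel 3 0 r) (-1) (x 0 ⟨r, fun _ hq => hPr'' (hr (Finset.mem_coe.2 hq))⟩)))) -
              ((s : ℚ_[3]) ⊗ₜ[ℚ] (1 : CyclotomicField (cycLevel 3 0 r) ℚ)) =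
            (((3 : ℕ) : ℤ_[3]) ^ (m + 1)) • (l : ℚ_[3] ⊗[ℚ] CyclotomicField (cycLevel 3 0 r) ℚ)) ∧
          haveI : NeZero (∏ q ∈ r, Ideal.absNorm q.asIdeal) :=
            ⟨Finset.prod_ne_zero_iff.2 fun q _ h => q.ne_bot (Ideal.absNorm_eq_zero_iff.1 h)⟩
          PadicInt.toZModPow (m + 1) s = (u : ZMod (3 ^ (m + 1))) *
            ((3 : ℕ) : ZMod (3 ^ (m + 1))) ^ t *
              kuriharaNumber P.f (3 ^ (m + 1)) (∏ q ∈ r, Ideal.absNorm q.asIdeal) ψ) :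
    ∃ (κf : Finset (HeightOneSpectrum (𝓞 ℚ)) →
          galoisCohomology (W.torsionGaloisModule (((3 : ℕ) : ℤ) ^ k * ((3 : ℕ) : ℤ))) 1)
      (κu : Finset (HeightOneSpectrum (𝓞 ℚ)) →
          galoisCohomology (W.torsionGaloisModule (((3 : ℕ) : ℤ) ^ m * ((3 : ℕ) : ℤ))) 1),
      KatoKuriharaWitnessAt W k t D v₃ P κf Λk κf ∧
      KatoKuriharaWitnessAt W m t D'' v₃ P κu Λm κu ∧
      κf ∈ D.kolyvaginSystems (blochKatoSelmerStructure 3 (tateTorsionDatum W 3 k) (fun _ _ => ⊤)) ∧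
      κu ∈ D''.kolyvaginSystems (blochKatoSelmerStructure 3 (tateTorsionDatum W 3 m) (fun _ _ => ⊤)) ∧
      ∀ e, D''.IsLevel e → D.IsLevel e → galoisCohomology.map π 1 (κu e) = κf e := by
  haveI : Fact (Nat.Prime 3) := ⟨Nat.prime_three⟩
  letI := TorsionCoeff.torsionBy.padicIntModule 3 (k + 1) (WeierstrassCurve.geomPoints W)
  letI := TorsionCoeff.torsionBy.padicIntModule 3 (m + 1) (WeierstrassCurve.geomPoints W)
  have hv₃p : ((primesEquiv v₃ : Nat.Primes) : ℕ) = 3 := primesEquiv_eq_of_natCast_mem Nat.prime_three hv₃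
  -- the two coefficient systems `E[3^{j+1}]_{ℤ₃}` (GZ-2), reductions onto, pins `rfl`
  have hredk : Function.Surjective
      (tateModuleRed W 3 (W.continuous_galoisRepTate_holds 3) (k + 1)).hom := by
    intro y
    obtain ⟨b, hb⟩ := W.proj_surjective_of_isAlgClosed_holds 3 (k + 1) y.2
    exact ⟨b, Subtype.ext hb⟩
  have hredm : Function.Surjective
      (tateModuleRed W 3 (W.continuous_galoisRepTate_holds 3) (m + 1)).hom := by
    intro y
    obtain ⟨b, hb⟩ := W.proj_surjective_of_isAlgClosed_holds 3 (m + 1) y.2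
    exact ⟨b, Subtype.ext hb⟩
  -- THEOREM D-u at the two depths for Kato's system `z` (seat gen 2): ONE `σ`, (COMP); `hur` = (C2)
  obtain ⟨σ, Φ, comm, κf, Φ'', comm'', κu, hσI, hσχ, hΦ, hΦ'', hKS, hKS'', -, -, hres, hres'', hcomp⟩ :=
    exists_isKolyvaginSystem_pair_blochKatoSelmerStructure_of_unramified_odd W 3 (badPlaces c d A N)
      (by decide) hkm hbody.1
      (tateModuleRed W 3 (W.continuous_galoisRepTate_holds 3) (k + 1)) hredk
      (fun y => pow_smul_eq_zero 3 (k + 1) _ y)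
      (AddSubgroup.inclusion (geomTorsion_pow_succ_eq W 3 k).le : _ →+ _) continuous_of_discreteTopology
      (fun _ _ => rfl)
      (AddSubgroup.inclusion (geomTorsion_pow_succ_eq W 3 k).ge : _ →+ _) continuous_of_discreteTopology
      (fun y => Subtype.ext rfl) (fun y => Subtype.ext rfl) (fun _ => rfl)
      (tateModuleRed W 3 (W.continuous_galoisRepTate_holds 3) (m + 1)) hredm
      (fun y => pow_smul_eq_zero 3 (m + 1) _ y)
      (AddSubgroup.inclusion (geomTorsion_pow_succ_eq W 3 m).le : _ →+ _) continuous_of_discreteTopology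
      (fun _ _ => rfl)
      (AddSubgroup.inclusion (geomTorsion_pow_succ_eq W 3 m).ge : _ →+ _) continuous_of_discreteTopology
      (fun y => Subtype.ext rfl) (fun y => Subtype.ext rfl) (fun _ => rfl)
      π hπ hirr D hT D'' hT'' hD hD'' hPr hPr'' hKol hKol'' hbody.2.1 htopk htopm
  -- `KS(𝓕_u) ≤ KS(𝓕_can)` (part IX over part XVIII, `p = 3` odd)
  have hKSc : D.IsKolyvaginSystem (propagatedSelmerStructure W 3 k) κf :=
    (KolyvaginDatum.mem_kolyvaginSystems_iff _ _ _).1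
      (kolyvaginSystems_mono D (blochKatoSelmerStructure_relaxed_le_propagatedSelmerStructure W 3 k (by norm_num))
        ((KolyvaginDatum.mem_kolyvaginSystems_iff _ _ _).2 hKS))
  have hKSc'' : D''.IsKolyvaginSystem (propagatedSelmerStructure W 3 m) κu :=
    (KolyvaginDatum.mem_kolyvaginSystems_iff _ _ _).1
      (kolyvaginSystems_mono D'' (blochKatoSelmerStructure_relaxed_le_propagatedSelmerStructure W 3 m (by norm_num))
        ((KolyvaginDatum.mem_kolyvaginSystems_iff _ _ _).2 hKS''))
  refine ⟨κf, κu, ?_, ?_, (KolyvaginDatum.mem_kolyvaginSystems_iff _ _ _).2 hKS,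
    (KolyvaginDatum.mem_kolyvaginSystems_iff _ _ _).2 hKS'', fun e he'' he => hcomp e he he''⟩
  · -- depth `k`: (0), (I4) with `κ′ = κ`, (Λ) from the rider, (DICT3) per level from T-PK6-GEN
    refine ⟨fun e he => hKSc.mem_selmerGroup e he,
      ⟨hKSc, fun e _ => by rw [sub_self]; exact zero_mem _⟩, hfink.1, hfink.2.1, fun r hr => ?_⟩
    obtain ⟨s, u, ψ, hψ, hval, hw⟩ := hvalk σ hσI hσχ r hr
    obtain ⟨u', hu'⟩ := GeneralLevel.exists_unit_apply_localization_eq_of_derivativeFamily W 3 P.f ι κK Λ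
      c d a A z x (by decide) hbody hfink
      (tateModuleRed W 3 (W.continuous_galoisRepTate_holds 3) (k + 1))
      (AddSubgroup.inclusion (geomTorsion_pow_succ_eq W 3 k).le : _ →+ _) continuous_of_discreteTopology
      (fun _ _ => rfl) (fun _ => rfl) D hPr σ Φ comm κf hΦ hKSc hres hv₃p r hr s hval u hw
    exact ⟨u', ψ, hψ, hu'⟩
  · -- depth `m`: the same
    refine ⟨fun e he => hKSc''.mem_selmerGroup e he,
      ⟨hKSc'', fun e _ => by rw [sub_self]; exact zero_mem _⟩, hfinm.1, hfinm.2.1, fun r hr => ?_⟩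
    obtain ⟨s, u, ψ, hψ, hval, hw⟩ := hvalm σ hσI hσχ r hr
    obtain ⟨u', hu'⟩ := GeneralLevel.exists_unit_apply_localization_eq_of_derivativeFamily W 3 P.f ι κK Λ
      c d a A z x (by decide) hbody hfinm
      (tateModuleRed W 3 (W.continuous_galoisRepTate_holds 3) (m + 1))
      (AddSubgroup.inclusion (geomTorsion_pow_succ_eq W 3 m).le : _ →+ _) continuous_of_discreteTopology
      (fun _ _ => rfl) (fun _ => rfl) D'' hPr'' σ Φ'' comm'' κu hΦ'' hKSc'' hres'' hv₃p r hr s hval u hw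
    exact ⟨u', ψ, hψ, hu'⟩


set_option backward.isDefEq.respectTransparency false in
/-- **The ONE-DEPTH reading** (`k = m`, `π` = the pinned reduction `x ↦ 3^0·x` of
`exists_torsionReduction_three W k k`): from `ZetaBody`, the rider at depth `k`, a canonical datum `D` with
usable Kolyvagin primes of level `k + 1`, `𝓕_can,3 = ⊤` at depth `k` and the depth-`k` value rows — a PORT″
witness `KatoKuriharaWitnessAt W k t D v₃ P κ Λk κ` whose Kolyvagin system lies in `KS(E[3^k·3], 𝓕_u, D)`;
this is exactly the input `hwit k` of part XXIII's deep bound.  NO `hbad`.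
[cite: Kato2004Asterisque, (8.1.3) (p. 180) and Thm. 9.7 (p. 189)] [cite: Kim2022StructureSelmer, Thm. 3.13 (arXiv p. 17)]
[cite: MazurRubin2004, Thm. 3.2.4, App. A (33) and Remark A.5 (p. 81)] -/
theorem exists_katoKuriharaWitnessAt_blochKato_of_zetaBody
    {N : ℕ} [NeZero N] (P : ModularParametrizationData W N)
    {ι : (n : ℕ) → (CyclotomicField n ℚ →+* ℂ)} {κK : ℝ}
    {Λ : ∀ (k' : ℕ) (r : Finset (HeightOneSpectrum (𝓞 ℚ))),
      H1 (tateRep W 3) (cycSubgroup 3 k' r) →ₗ[ℤ_[3]] ℚ_[3] ⊗[ℚ] CyclotomicField (cycLevel 3 k' r) ℚ}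
    {c d a : ℤ} {A : ℕ}
    {z : ∀ (k' : ℕ) (r : (cyclotomicLevelsRat 3 (badPlaces c d A N)).Ideals),
      H1 (tateRep W 3) ((cyclotomicLevelsRat 3 (badPlaces c d A N)).level k' r.1)}
    {x : ∀ (k' : ℕ) (r : (cyclotomicLevelsRat 3 (badPlaces c d A N)).Ideals),
      CyclotomicField (cycLevel 3 k' r.1) ℚ}
    (hbody : ZetaBody W 3 P.f ι κK Λ c d a A z x)
    (hirr : W.HasIrreducibleModPGaloisRep 3) (k : ℕ)
    {t : ℕ} {v₃ : HeightOneSpectrum (𝓞 ℚ)} (hv₃ : ((3 : ℕ) : 𝓞 ℚ) ∈ v₃.asIdeal)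
    {Λk : galoisCohomology ((W.torsionGaloisModule (((3 : ℕ) : ℤ) ^ k * ((3 : ℕ) : ℤ))).toLocal
      (Sum.inr v₃)) 1 →+ ZMod (3 ^ (k + 1))}
    (hfink : KatoExpStarFiniteLevelAt W 3 k t v₃ Λ Λk)
    (D : KolyvaginDatum (W.torsionGaloisModule (((3 : ℕ) : ℤ) ^ k * ((3 : ℕ) : ℤ))))
    (hT : D.transverse = cyclotomicTransverse (W.torsionGaloisModule (((3 : ℕ) : ℤ) ^ k * ((3 : ℕ) : ℤ))))
    {η : (q : HeightOneSpectrum (𝓞 ℚ)) → (ZMod (Ideal.absNorm q.asIdeal))ˣ}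
    (hD : D.HasCanonicalComparison (3 ^ (k + 1)) η)
    (hPr : D.primes ⊆ (cyclotomicLevelsRat 3 (badPlaces c d A N)).primes)
    (hKol : ∀ q ∈ D.primes, Kato.IsKolyvaginPrime W 3 (k + 1) ((primesEquiv q : Nat.Primes) : ℕ))
    (htopk : ∀ w : HeightOneSpectrum (𝓞 ℚ), ((primesEquiv w : Nat.Primes) : ℕ) = 3 →
      propagatedSelmerStructure W 3 k (Sum.inr w) = ⊤)
    (hvalk : ∀ σ : HeightOneSpectrum (𝓞 ℚ) → absoluteGaloisGroup ℚ,
      (∀ q, σ q ∈ (adicCompletionPrime ℚ q).inertia (absoluteGaloisGroup ℚ)) →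
      (∀ q, modNCyclotomicCharacter ℚ (Ideal.absNorm q.asIdeal) (σ q) = η q) →
      ∀ (r : Finset (HeightOneSpectrum (𝓞 ℚ))) (hr : (↑r : Set _) ⊆ D.primes),
        ∃ (s : ℤ_[3]) (u : (ZMod (3 ^ (k + 1)))ˣ)
          (ψ : (ℓ : ℕ) → (ZMod ℓ)ˣ →* Multiplicative (ZMod (3 ^ (k + 1)))),
          (∀ q ∈ r, Function.Surjective (ψ (Ideal.absNorm q.asIdeal))) ∧
          (∃ l ∈ cycIntLattice 3 (cycLevel 3 0 r),
            (((3 : ℕ) : ℤ_[3]) ^ t) • ((1 : ℚ_[3]) ⊗ₜ[ℚ]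
              ((r.noncommProd 𝐃F⟦r, σ⟧ (ZetaValue.pairwise_commute_fieldDeriv (cycLevel 3 0 r)
                  (fun ℓ => modNCyclotomicCharacter ℚ (cycLevel 3 0 r) (σ ℓ))
                  (fun ℓ => ((primesEquiv ℓ : Nat.Primes) : ℕ) - 1) r))
                (x 0 ⟨r, fun _ hq => hPr (hr (Finset.mem_coe.2 hq))⟩ +
                  sigma (cycLevel 3 0 r) (-1) (x 0 ⟨r, fun _ hq => hPr (hr (Finset.mem_coe.2 hq))⟩)))) -
              ((s : ℚ_[3]) ⊗ₜ[ℚ] (1 : CyclotomicField (cycLevel 3 0 r) ℚ)) =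
            (((3 : ℕ) : ℤ_[3]) ^ (k + 1)) • (l : ℚ_[3] ⊗[ℚ] CyclotomicField (cycLevel 3 0 r) ℚ)) ∧
          haveI : NeZero (∏ q ∈ r, Ideal.absNorm q.asIdeal) :=
            ⟨Finset.prod_ne_zero_iff.2 fun q _ h => q.ne_bot (Ideal.absNorm_eq_zero_iff.1 h)⟩
          PadicInt.toZModPow (k + 1) s = (u : ZMod (3 ^ (k + 1))) *
            ((3 : ℕ) : ZMod (3 ^ (k + 1))) ^ t *
              kuriharaNumber P.f (3 ^ (k + 1)) (∏ q ∈ r, Ideal.absNorm q.asIdeal) ψ) :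
    ∃ κ : Finset (HeightOneSpectrum (𝓞 ℚ)) →
        galoisCohomology (W.torsionGaloisModule (((3 : ℕ) : ℤ) ^ k * ((3 : ℕ) : ℤ))) 1,
      KatoKuriharaWitnessAt W k t D v₃ P κ Λk κ ∧
      κ ∈ D.kolyvaginSystems (blochKatoSelmerStructure 3 (tateTorsionDatum W 3 k) (fun _ _ => ⊤)) := by
  obtain ⟨red, hred⟩ := exists_torsionReduction_three W k k
  obtain ⟨κf, -, h₁, -, h₃, -, -⟩ := exists_katoKuriharaWitnessAt_pair_blochKato_of_zetaBody W P hbody hirr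
    le_rfl red hred hv₃ hfink hfink D hT D hT hD hD hPr hPr hKol hKol htopk htopk hvalk hvalk
  exact ⟨κf, h₁, h₃⟩

end Summit.BirchSwinnertonDyer.BirchSwinnertonDyer.Theorems.KimAtThreeD7uTamagawaKuriharaWitness

end
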